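import Summits.QuantumFields.YangMills.Theorems.BalabanUVNodesN21ThresholdMixture
import Summits.QuantumFields.YangMills.Theorems.BalabanUVNodesN21AtSpineCarriersMeasure
import Summits.QuantumFields.YangMills.Theorems.BalabanUVNodesN21AtSpineCarriersSanity

/-!
# YM-DAG node N21 (= NE7c) — THE THRESHOLD MIXTURE ON ROAD I: with MIXTURE slot measures `μ ⊗ Leb|[(1 − κ_j)θ_j, θ_j]` the wall (M1) of
# road I is a THEOREM at EVERY level (constant `D_j = 2κ_j⁻¹`, any field law), so END-I's measure-level reading of the K5 stub
# (`…N21AtSpineCarriersMeasure.s_N21_of_slotACReading`, p419030) closes `S_N21 SRec` from the [dict] push at the mixture measure (NODE O), the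
# live windows (N20) and the width rate (N16) ALONE — no anti-concentration binder, no sibling suppression, no profiled tower

Track A of `YM-PLAN.md` (cell `pub-ymgap`, HUMAN RULING D-0062), node **N21**; R141 (C) fan-out seat `pub-ymgap-dag-n21-e` (s3 = ALTERNATIVE
CURRENCY), generation 2, file 7 — the ROAD-I face of the lens memo's Card 5 (`ym-lens-BalabanUVNodes-nearmiss/LENS-nearmiss.md` v2.0 §2,
MECHANISM (4): «the wall per slot: `μ ⊗ Leb|[(1−κ)θ, θ] {s(1−ρ) ≤ u < s} ≤ θρ∕(1−ρ)·μ(univ)` for ANY μ — (M1) with `D = ((1−ρ)κ)⁻¹`»; pub-ymgap INBOX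
l.13275), companion of files 5a `…N21ThresholdMixture` (p466893: `slotAntiConcentration_thresholdMixture`), 5b `…ThresholdMixtureRepr`, 6
`…AtSpineCarriersMixture` (the (η) face).  Kernel bookkeeping BY NAME: 0 `def`, 0 `sorry`, standard axioms.  COUNT-NEUTRAL; `--supports` the K3′
item `SpineGivenEndpointR12` as a helper.

HONEST FRAMING.  NE7c is NOT PRINTED and NOT PROVED; print fixes its thresholds once.  On the MIXTURE road the slot measure of a live slot at
level `j` is the product of the run's slot-removed field law `ν` (ANY finite measure: the term object, NODE O) with Lebesgue measure on the
threshold interval `[(1 − κ_j)θ_j, θ_j]`, and the tested variable is the rescaled `θ_j·u∕s`; for these, (M1) `T4ShellMeasure.SlotAntiConcentration`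
HOLDS with `D_j = 2κ_j⁻¹` for EVERY relative width `ρ ≥ 0` (§1: file 5a's Fubini lemma for `ρ ≤ 1∕2`, the trivial bound beyond).  So road I's
END-I (`ShellMeasureRootComposition.levelLedger_of_slotAC` ∘ `n21_knit_levels`) closes from: the [dict] push AT THE MIXTURE MEASURE (`piece_le`,
`total_ge`: the record's term sum written as a threshold mixture — located input (O-mix-1), NODE O at the Stage-12 record; the card's cheapest
falsifier (K-ii) «is the threshold a free argument of `Node00.chiOfRecord`, read nowhere else?»), admissible widths `κ_min ≤ κ_j < 1`
(`T4LipschitzCutoff` §5∕§7; ONE multiplier per OCCURRENCE, (O-mix-3)), the live windows (N20), and the width rate `ρ_j ≤ c₁ϑ^j` (N16, (F∞) uniform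
over the multipliers, (O-mix-2)).  NO (M1) binder, NO `SiblingSuppression`, NO profiled tower.  Not print's construction verbatim (a convex
combination of print's sharp procedure over admissible threshold vectors); NOT (M1) for the deterministic sharp procedure; N16 ∕ N20 untouched;
N21 NOT discharged; one finite four-torus programme at fixed `ε`; NOT continuum ∕ ℝ⁴ ∕ OS ∕ mass gap ∕ Clay.

CITATION HEADER (lean-in-tree rule 2026-08-18).  Everything BY NAME from the tree: file 5a `slotAntiConcentration_thresholdMixture` (lens seat
ym-lens-BalabanUVNodes-nearmiss g2, landed p466893); `ShellMeasureRootComposition.levelLedger_of_slotAC` (p207618 lineage); file 1 of n21-a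
`…N21ShellWeightKnit.n21_knit_levels` (p408928); `T4ShellMeasure.SlotAntiConcentration`; `T4ShellMeasureLevels.LevelLedger` ∕ `LiveWindow` ∕ `Toy`;
`…N21AtSpineCarriers.exists_family_and_datum` (p419285).  Context only (SHAPE): [Balaban1988Convergent] (2.17)∕(2.18) p. 257; [Balaban1989LargeFieldI]
(1.22) p. 181 (the non-sharp threshold ladder — the slack the multipliers live in).

WHAT IS PROVED ([folklore]).  §1 `slotAntiConcentration_thresholdMixture_two` ((M1) for the mixture slot measure with the width-free constant
`2κ⁻¹`, every `ρ ≥ 0`) · `two_mul_inv_le` (`2κ_j⁻¹ ≤ 2κ_min⁻¹`).  §2 `levelLedger_of_mixtureSlots` (ONE run: road I's `LevelLedger` with `D_j = 2κ_j⁻¹`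
from (R) + the [dict] push at the mixture measures — (M1) DISCHARGED) · `n21_knit_mixtureSlots` (two runs + windows + `κ_min` + rate ⇒ `ShellWeightBound`
with the geometric weight of `n21_knit_levels` at `D̄ = 2κ_min⁻¹`).  §3 `s_N21_of_mixtureSlotReading` (the same at the K5 stub, ∃-closed exactly as
`s_N21_of_slotACReading` with the `hac` binder GONE).  §4 VACUITY GUARD: `toyMix_total` ∕ `toyMix_shell_pos` (a one-slot mixture measure `δ ⊗ Leb|[1∕2, 1]`
at tested value `3∕4` has total mass `1∕2` and POSITIVE shell mass at every width `0 < ρ < 1`) · `s_N21_fires_on_mixtureSlotReading` (the reading is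
INHABITED by a bundle with nonempty classes, positive weights, positive shell parts and positive record weight, and `S_N21` holds on it).
-/

set_option autoImplicit false

noncomputable section

open scoped BigOperators ENNReal
open MeasureTheory Set

namespace Summit.QuantumFields.YangMills.Theorems.N21MixtureSlotMeasure

open Literature.MathematicalPhysics.QuantumFieldTheory.Balaban1983to89
open T4IndicatorShell (ShellWeightBound)
open T4ShellMeasure (SlotAntiConcentration)
open T4ShellMeasureLevels (LevelLedger LiveWindow)
open YMDAG.UVSplit (SpineCarriers SpineRecordPred S_N21)
open Summit.QuantumFields.BalabanUV.T4Continuum.ShellMeasureRootComposition (levelLedger_of_slotAC)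
open N21ThresholdMixture (slotAntiConcentration_thresholdMixture)

/-! ## §1 (M1) for the mixture slot measure with a width-free constant -/

section Wall

variable {X : Type*} [MeasurableSpace X]

/-- **(M1) FOR THE MIXTURE SLOT MEASURE, EVERY WIDTH.**  For any measure `μ`, measurable `u`, `θ > 0`, `0 < κ < 1` and EVERY `ρ ≥ 0`:
`SlotAntiConcentration (μ ⊗ Leb|[(1 − κ)θ, θ]) ((x, s) ↦ θ·u(x)∕s) θ ρ (2κ⁻¹)` — for `ρ ≤ 1∕2` this is file 5a's Fubini lemma
(`D = (1 − ρ)⁻¹κ⁻¹ ≤ 2κ⁻¹`), for `ρ > 1∕2` the bound is trivial (`2κ⁻¹ρ ≥ 1`). [folklore] -/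
theorem slotAntiConcentration_thresholdMixture_two (μ : Measure X) {u : X → ℝ} (hu : Measurable u) {θ ρ κ : ℝ} (hθ : 0 < θ)
    (hρ0 : 0 ≤ ρ) (hκ0 : 0 < κ) (hκ1 : κ < 1) :
    SlotAntiConcentration (μ.prod (volume.restrict (Icc ((1 - κ) * θ) θ))) (fun p : X × ℝ => θ * u p.1 / p.2) θ ρ (2 * κ⁻¹) := by
  by_cases hρ : ρ ≤ 1 / 2
  · have h := slotAntiConcentration_thresholdMixture μ hu hθ hρ0 (by linarith) hκ0 hκ1 (ρ := ρ)
    unfold SlotAntiConcentration at h ⊢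
    refine h.trans (mul_le_mul_of_nonneg_right (ENNReal.ofReal_le_ofReal (mul_le_mul_of_nonneg_right ?_ hρ0)) bot_le)
    have h1ρ : 0 < 1 - ρ := by linarith
    have hinv : (1 - ρ)⁻¹ ≤ 2 := by rw [inv_le_comm₀ h1ρ (by norm_num)]; linarith
    exact mul_le_mul_of_nonneg_right hinv (inv_nonneg.2 hκ0.le)
  · rw [not_le] at hρ
    unfold SlotAntiConcentration
    have hκinv : 1 ≤ κ⁻¹ := (one_le_inv₀ hκ0).2 hκ1.le
    have h1 : (1 : ℝ≥0∞) ≤ ENNReal.ofReal (2 * κ⁻¹ * ρ) := ENNReal.one_le_ofReal.2 (by nlinarith)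
    calc (μ.prod (volume.restrict (Icc ((1 - κ) * θ) θ))) {p : X × ℝ | θ * (1 - ρ) ≤ θ * u p.1 / p.2 ∧ θ * u p.1 / p.2 < θ}
        ≤ (μ.prod (volume.restrict (Icc ((1 - κ) * θ) θ))) univ := measure_mono (subset_univ _)
      _ ≤ ENNReal.ofReal (2 * κ⁻¹ * ρ) * (μ.prod (volume.restrict (Icc ((1 - κ) * θ) θ))) univ := le_mul_of_one_le_left bot_le h1

end Wall

/-- the level constants `2κ_j⁻¹` lie under `2κ_min⁻¹` when `0 < κ_min ≤ κ_j`. [folklore] -/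
theorem two_mul_inv_le {κmin x : ℝ} (hmin : 0 < κmin) (hx : κmin ≤ x) : 2 * x⁻¹ ≤ 2 * κmin⁻¹ :=
  mul_le_mul_of_nonneg_left ((inv_le_inv₀ (hmin.trans_le hx) hmin).2 hx) (by norm_num)

/-! ## §2 One run and two runs at explicit carriers: road I's level ledgers with (M1) DISCHARGED for mixture slot measures -/

section Explicit

variable {ι σ σ' : Type*} {XA : ℕ → σ → Type*} {XB : ℕ → σ' → Type*} [∀ K s, MeasurableSpace (XA K s)] [∀ K s, MeasurableSpace (XB K s)]
  {l₀ : ℝ} {T : ℕ → Finset ι} {A B shA shB : ℕ → ℝ → ι → ℝ} {SA : ℕ → Finset σ} {SB : ℕ → Finset σ'}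
  {pieceA : ℕ → ℝ → σ → ι → ℝ} {pieceB : ℕ → ℝ → σ' → ι → ℝ} {lvlA : ℕ → σ → ℕ} {lvlB : ℕ → σ' → ℕ}
  {νA : ∀ K : ℕ, ℝ → ∀ s : σ, Measure (XA K s)} {νB : ∀ K : ℕ, ℝ → ∀ s : σ', Measure (XB K s)}
  [∀ K t s, IsFiniteMeasure (νA K t s)] [∀ K t s, IsFiniteMeasure (νB K t s)]
  {wA : ∀ K : ℕ, ℝ → ∀ s : σ, XA K s → ℝ} {wB : ∀ K : ℕ, ℝ → ∀ s : σ', XB K s → ℝ}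
  {θA κA ρA θB κB ρB : ℕ → ℝ} {MA : ℕ → ℝ → σ → ℝ} {MB : ℕ → ℝ → σ' → ℝ}

/-- **ONE RUN: road I's `LevelLedger` with `D_j = 2κ_j⁻¹` FROM THE MIXTURE SLOT MEASURES.**  DATA: terms `T K` with weights `A` and shell parts `sh`;
slots `S K` at levels `lvl K s` with pieces `piece K t s`; per slot a FINITE field law `ν K t s` on `X K s` (the run's measure with the slot's own
indicator removed — the term object) and the slot's MEASURABLE tested variable `w K t s`; by level: thresholds `θ_j > 0`, admissible widths
`0 < κ_j < 1`, relative widths `ρ_j ≥ 0`; [dict] constants `M K t s ≥ 0`.  BINDERS: (R); the [dict] PUSH AT THE MIXTURE MEASURE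
`ν ⊗ Leb|[(1 − κ_j)θ_j, θ_j]` with tested variable `θ_j·w∕s` (`piece_le`, `total_ge`).  NO (M1) binder: it is §1's theorem. [folklore] -/
theorem levelLedger_of_mixtureSlots
    (sh_nonneg : ∀ K t, |t| ≤ l₀ → ∀ τ ∈ T K, 0 ≤ shA K t τ)
    (sh_le : ∀ K t, |t| ≤ l₀ → ∀ τ ∈ T K, shA K t τ ≤ A K t τ)
    (cover : ∀ K t, |t| ≤ l₀ → ∀ τ ∈ T K, shA K t τ ≤ ∑ s ∈ SA K, pieceA K t s τ)
    (hw : ∀ K t s, Measurable (wA K t s)) (hθ : ∀ j, 0 < θA j) (hκ : ∀ j, 0 < κA j ∧ κA j < 1) (hρ : ∀ j, 0 ≤ ρA j)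
    (hM : ∀ K t, |t| ≤ l₀ → ∀ s ∈ SA K, 0 ≤ MA K t s)
    (piece_le : ∀ K t, |t| ≤ l₀ → ∀ s ∈ SA K, ∑ τ ∈ T K, pieceA K t s τ ≤ MA K t s *
      (((νA K t s).prod (volume.restrict (Icc ((1 - κA (lvlA K s)) * θA (lvlA K s)) (θA (lvlA K s)))))
        {p | θA (lvlA K s) * (1 - ρA (lvlA K s)) ≤ θA (lvlA K s) * wA K t s p.1 / p.2 ∧
          θA (lvlA K s) * wA K t s p.1 / p.2 < θA (lvlA K s)}).toReal)
    (total_ge : ∀ K t, |t| ≤ l₀ → ∀ s ∈ SA K, MA K t s *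
      (((νA K t s).prod (volume.restrict (Icc ((1 - κA (lvlA K s)) * θA (lvlA K s)) (θA (lvlA K s))))) univ).toReal ≤
        ∑ τ ∈ T K, A K t τ) :
    LevelLedger l₀ T A shA SA pieceA lvlA (fun j => 2 * (κA j)⁻¹) ρA :=
  levelLedger_of_slotAC (Ω := fun K s => XA K s × ℝ)
    (μ := fun K t s => (νA K t s).prod (volume.restrict (Icc ((1 - κA (lvlA K s)) * θA (lvlA K s)) (θA (lvlA K s)))))
    (u := fun K t s p => θA (lvlA K s) * wA K t s p.1 / p.2) (θ := θA)
    sh_nonneg sh_le cover hM piece_le total_ge (fun j => by have := (hκ j).1; positivity) hρ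
    fun K t _ s _ => slotAntiConcentration_thresholdMixture_two (νA K t s) (hw K t s) (hθ _) (hρ _) (hκ _).1 (hκ _).2

/-- **TWO RUNS: N21'S ROAD-I KNIT WITH (M1) DISCHARGED ON THE MIXTURE ROAD.**  Two mixture level ledgers (§2, one per run; [dict] pushes at the
mixture measures), the two live windows `(N₁, ν̄)` (N20), admissible widths bounded below `κ_min ≤ κ_j` (`0 < κ_min`), the width rate `0 < ϑ < 1`,
`ρ_j ≤ c₁ϑ^j` in both runs (N16) ⟹ `ShellWeightBound l₀ T A B shA shB Wsh` for every summable `Wsh ≥ 2((N₁+1)ν̄·(2κ_min⁻¹)·c₁ϑ^{−N₁})ϑ^K`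
(`n21_knit_levels` at `D̄ = 2κ_min⁻¹`).  NO (M1), NO sibling suppression, NO profiled tower. [folklore] -/
theorem n21_knit_mixtureSlots
    (sh_nonnegA : ∀ K t, |t| ≤ l₀ → ∀ τ ∈ T K, 0 ≤ shA K t τ)
    (sh_leA : ∀ K t, |t| ≤ l₀ → ∀ τ ∈ T K, shA K t τ ≤ A K t τ)
    (coverA : ∀ K t, |t| ≤ l₀ → ∀ τ ∈ T K, shA K t τ ≤ ∑ s ∈ SA K, pieceA K t s τ)
    (hwA : ∀ K t s, Measurable (wA K t s)) (hθA : ∀ j, 0 < θA j) (hκA : ∀ j, 0 < κA j ∧ κA j < 1) (hρA : ∀ j, 0 ≤ ρA j)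
    (hMA : ∀ K t, |t| ≤ l₀ → ∀ s ∈ SA K, 0 ≤ MA K t s)
    (piece_leA : ∀ K t, |t| ≤ l₀ → ∀ s ∈ SA K, ∑ τ ∈ T K, pieceA K t s τ ≤ MA K t s *
      (((νA K t s).prod (volume.restrict (Icc ((1 - κA (lvlA K s)) * θA (lvlA K s)) (θA (lvlA K s)))))
        {p | θA (lvlA K s) * (1 - ρA (lvlA K s)) ≤ θA (lvlA K s) * wA K t s p.1 / p.2 ∧
          θA (lvlA K s) * wA K t s p.1 / p.2 < θA (lvlA K s)}).toReal)
    (total_geA : ∀ K t, |t| ≤ l₀ → ∀ s ∈ SA K, MA K t s *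
      (((νA K t s).prod (volume.restrict (Icc ((1 - κA (lvlA K s)) * θA (lvlA K s)) (θA (lvlA K s))))) univ).toReal ≤
        ∑ τ ∈ T K, A K t τ)
    (sh_nonnegB : ∀ K t, |t| ≤ l₀ → ∀ τ ∈ T K, 0 ≤ shB K t τ)
    (sh_leB : ∀ K t, |t| ≤ l₀ → ∀ τ ∈ T K, shB K t τ ≤ B K t τ)
    (coverB : ∀ K t, |t| ≤ l₀ → ∀ τ ∈ T K, shB K t τ ≤ ∑ s ∈ SB K, pieceB K t s τ)
    (hwB : ∀ K t s, Measurable (wB K t s)) (hθB : ∀ j, 0 < θB j) (hκB : ∀ j, 0 < κB j ∧ κB j < 1) (hρB : ∀ j, 0 ≤ ρB j)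
    (hMB : ∀ K t, |t| ≤ l₀ → ∀ s ∈ SB K, 0 ≤ MB K t s)
    (piece_leB : ∀ K t, |t| ≤ l₀ → ∀ s ∈ SB K, ∑ τ ∈ T K, pieceB K t s τ ≤ MB K t s *
      (((νB K t s).prod (volume.restrict (Icc ((1 - κB (lvlB K s)) * θB (lvlB K s)) (θB (lvlB K s)))))
        {p | θB (lvlB K s) * (1 - ρB (lvlB K s)) ≤ θB (lvlB K s) * wB K t s p.1 / p.2 ∧
          θB (lvlB K s) * wB K t s p.1 / p.2 < θB (lvlB K s)}).toReal)
    (total_geB : ∀ K t, |t| ≤ l₀ → ∀ s ∈ SB K, MB K t s *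
      (((νB K t s).prod (volume.restrict (Icc ((1 - κB (lvlB K s)) * θB (lvlB K s)) (θB (lvlB K s))))) univ).toReal ≤
        ∑ τ ∈ T K, B K t τ)
    {N₁ : ℕ} {νbar κmin c₁ ϑ : ℝ} (hwinA : LiveWindow SA lvlA N₁ νbar) (hwinB : LiveWindow SB lvlB N₁ νbar)
    (hκmin : 0 < κmin) (hκminA : ∀ j, κmin ≤ κA j) (hκminB : ∀ j, κmin ≤ κB j)
    (hϑ0 : 0 < ϑ) (hϑ1 : ϑ < 1) (hrateA : ∀ j, ρA j ≤ c₁ * ϑ ^ j) (hrateB : ∀ j, ρB j ≤ c₁ * ϑ ^ j)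
    {Wsh : ℕ → ℝ} (hWsh : ∀ K, (2 * ((N₁ + 1) * νbar * (2 * κmin⁻¹) * c₁ * ϑ⁻¹ ^ N₁)) * ϑ ^ K ≤ Wsh K) (hsum : Summable Wsh) :
    ShellWeightBound l₀ T A B shA shB Wsh :=
  n21_knit_levels
    (levelLedger_of_mixtureSlots sh_nonnegA sh_leA coverA hwA hθA hκA hρA hMA piece_leA total_geA)
    (levelLedger_of_mixtureSlots sh_nonnegB sh_leB coverB hwB hθB hκB hρB hMB piece_leB total_geB)
    hwinA hwinB (fun j => two_mul_inv_le hκmin (hκminA j)) (fun j => two_mul_inv_le hκmin (hκminB j)) hϑ0 hϑ1 hrateA hrateB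
    hWsh hsum

end Explicit

/-! ## §3 At the spine carriers: `S_N21 SRec` for every mixture-slot reading — END-I's reading with the (M1) binder GONE -/

section AtCarriers

variable {N : ℕ} [NeZero N]

/-- **`S_N21` FOR EVERY MIXTURE-SLOT READING.**  As `…N21AtSpineCarriersMeasure.s_N21_of_slotACReading` (END-I at the K5 stub), with the slot
measures SPECIALISED to the mixture form `ν ⊗ Leb|[(1 − κ_j)θ_j, θ_j]` (field law `ν K t s` finite, ANY; tested variable `θ_j·w∕s`, `w K t s`
measurable), admissible widths `κ_min ≤ κ_j < 1` (`0 < κ_min`), thresholds `θ_j > 0`, widths `0 ≤ ρ_j ≤ c₁ϑ^j` (N16), the [dict] push at the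
mixture measure (NODE O), live windows (N20) and a summable record weight `S.Wsh ≥ 2((N₁+1)ν̄(2κ_min⁻¹)c₁ϑ^{−N₁})ϑ^K` — and WITHOUT the wall
binder `hac`: (M1) is §1's theorem at `D_j = 2κ_j⁻¹`.  Then `S_N21 SRec` (§2). [folklore] -/
theorem s_N21_of_mixtureSlotReading (SRec : SpineRecordPred N)
    (hread : ∀ (F : T4Continuum.T4Family) (D : YMDAG.UVSplit.Datum F N) (g₀ : ℕ → ℝ)
      (os : List (T4Continuum.ULoop F)) (S : SpineCarriers), SRec F D g₀ os S →
      ∃ (σA σB : Type) (XA : ℕ → σA → Type) (XB : ℕ → σB → Type)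
        (_mA : ∀ K s, MeasurableSpace (XA K s)) (_mB : ∀ K s, MeasurableSpace (XB K s))
        (νA : ∀ K : ℕ, ℝ → ∀ s : σA, Measure (XA K s)) (νB : ∀ K : ℕ, ℝ → ∀ s : σB, Measure (XB K s))
        (_fA : ∀ K t s, IsFiniteMeasure (νA K t s)) (_fB : ∀ K t s, IsFiniteMeasure (νB K t s))
        (wA : ∀ K : ℕ, ℝ → ∀ s : σA, XA K s → ℝ) (wB : ∀ K : ℕ, ℝ → ∀ s : σB, XB K s → ℝ)
        (SA : ℕ → Finset σA) (SB : ℕ → Finset σB)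
        (pieceA : ℕ → ℝ → σA → S.ι → ℝ) (pieceB : ℕ → ℝ → σB → S.ι → ℝ)
        (lvlA : ℕ → σA → ℕ) (lvlB : ℕ → σB → ℕ) (θA κA ρA θB κB ρB : ℕ → ℝ)
        (MA : ℕ → ℝ → σA → ℝ) (MB : ℕ → ℝ → σB → ℝ) (N₁ : ℕ) (νbar κmin c₁ ϑ : ℝ),
        -- run A: (R), measurability, signs, [dict] push AT THE MIXTURE MEASURE
        (∀ K t, |t| ≤ S.l₀ → ∀ τ ∈ S.T K, 0 ≤ S.shA K t τ) ∧
        (∀ K t, |t| ≤ S.l₀ → ∀ τ ∈ S.T K, S.shA K t τ ≤ S.A K t τ) ∧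
        (∀ K t, |t| ≤ S.l₀ → ∀ τ ∈ S.T K, S.shA K t τ ≤ ∑ s ∈ SA K, pieceA K t s τ) ∧
        (∀ K t s, Measurable (wA K t s)) ∧ (∀ j, 0 < θA j) ∧ (∀ j, 0 < κA j ∧ κA j < 1) ∧ (∀ j, 0 ≤ ρA j) ∧
        (∀ K t, |t| ≤ S.l₀ → ∀ s ∈ SA K, 0 ≤ MA K t s) ∧
        (∀ K t, |t| ≤ S.l₀ → ∀ s ∈ SA K, ∑ τ ∈ S.T K, pieceA K t s τ ≤ MA K t s *
          (((νA K t s).prod (volume.restrict (Icc ((1 - κA (lvlA K s)) * θA (lvlA K s)) (θA (lvlA K s)))))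
            {p | θA (lvlA K s) * (1 - ρA (lvlA K s)) ≤ θA (lvlA K s) * wA K t s p.1 / p.2 ∧
              θA (lvlA K s) * wA K t s p.1 / p.2 < θA (lvlA K s)}).toReal) ∧
        (∀ K t, |t| ≤ S.l₀ → ∀ s ∈ SA K, MA K t s *
          (((νA K t s).prod (volume.restrict (Icc ((1 - κA (lvlA K s)) * θA (lvlA K s)) (θA (lvlA K s))))) univ).toReal ≤
            ∑ τ ∈ S.T K, S.A K t τ) ∧
        -- run B: the same
        (∀ K t, |t| ≤ S.l₀ → ∀ τ ∈ S.T K, 0 ≤ S.shB K t τ) ∧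
        (∀ K t, |t| ≤ S.l₀ → ∀ τ ∈ S.T K, S.shB K t τ ≤ S.B K t τ) ∧
        (∀ K t, |t| ≤ S.l₀ → ∀ τ ∈ S.T K, S.shB K t τ ≤ ∑ s ∈ SB K, pieceB K t s τ) ∧
        (∀ K t s, Measurable (wB K t s)) ∧ (∀ j, 0 < θB j) ∧ (∀ j, 0 < κB j ∧ κB j < 1) ∧ (∀ j, 0 ≤ ρB j) ∧
        (∀ K t, |t| ≤ S.l₀ → ∀ s ∈ SB K, 0 ≤ MB K t s) ∧
        (∀ K t, |t| ≤ S.l₀ → ∀ s ∈ SB K, ∑ τ ∈ S.T K, pieceB K t s τ ≤ MB K t s *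
          (((νB K t s).prod (volume.restrict (Icc ((1 - κB (lvlB K s)) * θB (lvlB K s)) (θB (lvlB K s)))))
            {p | θB (lvlB K s) * (1 - ρB (lvlB K s)) ≤ θB (lvlB K s) * wB K t s p.1 / p.2 ∧
              θB (lvlB K s) * wB K t s p.1 / p.2 < θB (lvlB K s)}).toReal) ∧
        (∀ K t, |t| ≤ S.l₀ → ∀ s ∈ SB K, MB K t s *
          (((νB K t s).prod (volume.restrict (Icc ((1 - κB (lvlB K s)) * θB (lvlB K s)) (θB (lvlB K s))))) univ).toReal ≤
            ∑ τ ∈ S.T K, S.B K t τ) ∧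
        -- windows (N20), admissible widths, rate (N16), record weight
        LiveWindow SA lvlA N₁ νbar ∧ LiveWindow SB lvlB N₁ νbar ∧ 0 < κmin ∧ (∀ j, κmin ≤ κA j) ∧ (∀ j, κmin ≤ κB j) ∧
        0 < ϑ ∧ ϑ < 1 ∧ (∀ j, ρA j ≤ c₁ * ϑ ^ j) ∧ (∀ j, ρB j ≤ c₁ * ϑ ^ j) ∧
        (∀ K, (2 * ((N₁ + 1) * νbar * (2 * κmin⁻¹) * c₁ * ϑ⁻¹ ^ N₁)) * ϑ ^ K ≤ S.Wsh K) ∧ Summable S.Wsh) :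
    S_N21 SRec := by
  intro F D g₀ os S hS
  obtain ⟨σA, σB, XA, XB, mA, mB, νA, νB, fA, fB, wA, wB, SA, SB, pieceA, pieceB, lvlA, lvlB, θA, κA, ρA, θB, κB, ρB, MA, MB, N₁,
    νbar, κmin, c₁, ϑ, sh_nonnegA, sh_leA, coverA, hwA, hθA, hκA, hρA, hMA, piece_leA, total_geA, sh_nonnegB, sh_leB, coverB, hwB,
    hθB, hκB, hρB, hMB, piece_leB, total_geB, hwinA, hwinB, hκmin, hκminA, hκminB, hϑ0, hϑ1, hrA, hrB, hWsh, hsum⟩ :=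
    hread F D g₀ os S hS
  exact n21_knit_mixtureSlots sh_nonnegA sh_leA coverA hwA hθA hκA hρA hMA piece_leA total_geA sh_nonnegB sh_leB coverB hwB hθB
    hκB hρB hMB piece_leB total_geB hwinA hwinB hκmin hκminA hκminB hϑ0 hϑ1 hrA hrB hWsh hsum

end AtCarriers

/-! ## §4 Vacuity guard: a one-slot mixture model inhabits the reading non-degenerately and `S_N21` FIRES on it -/

section NonVacuity

/-- THE TOY MIXTURE SLOT MEASURE `δ_() ⊗ Leb|[1∕2, 1]` (one field point, threshold uniform in `[1∕2, 1]`) has total mass `1∕2`. [folklore] -/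
theorem toyMix_total :
    ((Measure.dirac ()).prod (volume.restrict (Icc ((1 - (1 / 2 : ℝ)) * 1) 1))) univ = ENNReal.ofReal (1 / 2) := by
  rw [← univ_prod_univ, Measure.prod_prod, Measure.restrict_apply MeasurableSet.univ, univ_inter, Real.volume_Icc, measure_univ, one_mul]
  norm_num

/-- … and at tested value `3∕4` the mixture shell of relative width `ρ ∈ (0, 1)` — the threshold event `{s : s(1 − ρ) ≤ 3∕4 < s}` — contains the
rectangle `() × (3∕4, min 1 (3∕(4(1 − ρ)))]` of POSITIVE Lebesgue length: the shell mass is positive. [folklore] -/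
theorem toyMix_shell_pos {ρ : ℝ} (hρ0 : 0 < ρ) (hρ1 : ρ < 1) :
    0 < (((Measure.dirac ()).prod (volume.restrict (Icc ((1 - (1 / 2 : ℝ)) * 1) 1)))
      {p : Unit × ℝ | 1 * (1 - ρ) ≤ 1 * (3 / 4 : ℝ) / p.2 ∧ 1 * (3 / 4 : ℝ) / p.2 < 1}).toReal := by
  have h1ρ : 0 < 1 - ρ := by linarith
  set b : ℝ := min 1 (3 / (4 * (1 - ρ))) with hb
  have hb34 : 3 / 4 < b := by
    rw [hb, lt_min_iff]
    refine ⟨by norm_num, ?_⟩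
    rw [lt_div_iff₀ (by positivity)]
    nlinarith
  have hsub : (univ : Set Unit) ×ˢ Ioc (3 / 4 : ℝ) b ⊆
      {p : Unit × ℝ | 1 * (1 - ρ) ≤ 1 * (3 / 4 : ℝ) / p.2 ∧ 1 * (3 / 4 : ℝ) / p.2 < 1} := by
    rintro ⟨x, s⟩ ⟨-, hs1, hs2⟩
    have hs0 : 0 < s := by linarith
    have hsb : s ≤ 3 / (4 * (1 - ρ)) := hs2.trans (min_le_right _ _)
    simp only [mem_setOf_eq, one_mul]
    constructor
    · rw [le_div_iff₀ hs0]
      rw [le_div_iff₀ (by positivity)] at hsb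
      nlinarith
    · rw [div_lt_one hs0]; exact hs1
  have hIoc : Ioc (3 / 4 : ℝ) b ⊆ Icc ((1 - (1 / 2 : ℝ)) * 1) 1 := fun s hs =>
    ⟨by norm_num; linarith [hs.1], hs.2.trans (min_le_left _ _)⟩
  refine ENNReal.toReal_pos (ne_of_gt (lt_of_lt_of_le ?_ (measure_mono hsub))) (measure_ne_top _ _)
  rw [Measure.prod_prod, measure_univ, one_mul, Measure.restrict_apply measurableSet_Ioc,
    inter_eq_left.2 hIoc, Real.volume_Ioc]
  exact ENNReal.ofReal_pos.2 (by linarith)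

open T4ShellMeasureLevels.Toy (T S lvl liveWindow)

/-- **THE MIXTURE-SLOT READING IS INHABITED AND `S_N21` FIRES ON IT.**  There is a carrier predicate `SRec` over `SU(2)` data such that (i) `SRec`
is a MIXTURE-SLOT reading predicate — every bundle it pins carries EXACTLY the package of §3's `s_N21_of_mixtureSlotReading`; (ii) it is
INHABITED: one term and one slot per step at the top level (`T4ShellMeasureLevels.Toy.T∕S∕lvl`, window depth `0`), field law the Dirac mass at one
point, tested value `3∕4`, threshold `1`, width `κ = 1∕2` (so the slot measure is `δ ⊗ Leb|[1∕2, 1]`, total mass `1∕2`), relative widths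
`ρ_j = (1∕2)^j∕8`, [dict] constants `M = 1` with the pieces ∕ weights DEFINED as the mixture shell ∕ total masses (the push holds with equality), and the
record weight the knit's own geometric majorant; the bundle has nonempty classes, positive weights `1∕2`, POSITIVE shell parts (`toyMix_shell_pos`) and
positive record weight; (iii) `S_N21 SRec` holds (by §3).  A toy, NOT Bałaban's terms. [folklore] -/
theorem s_N21_fires_on_mixtureSlotReading :
    ∃ SRec : SpineRecordPred 2,
      (∃ (F : T4Continuum.T4Family) (D : YMDAG.UVSplit.Datum F 2) (g₀ : ℕ → ℝ) (os : List (T4Continuum.ULoop F))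
          (S : SpineCarriers), SRec F D g₀ os S ∧ (∀ K, (S.T K).Nonempty) ∧
          (∀ K t τ, 0 < S.A K t τ ∧ 0 < S.B K t τ ∧ 0 < S.shA K t τ ∧ 0 < S.shB K t τ) ∧ ∀ K, 0 < S.Wsh K) ∧
      S_N21 SRec := by
  obtain ⟨F, ⟨Dat⟩⟩ := N21AtSpineCarriers.exists_family_and_datum
  -- the toy slot measure and its shell / total masses
  let μ₀ : Measure (Unit × ℝ) := (Measure.dirac ()).prod (volume.restrict (Icc ((1 - (1 / 2 : ℝ)) * 1) 1))
  let ρ : ℕ → ℝ := fun j => (1 / 2 : ℝ) ^ j / 8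
  let shell : ℕ → ℝ := fun K => (μ₀ {p : Unit × ℝ | 1 * (1 - ρ K) ≤ 1 * (3 / 4 : ℝ) / p.2 ∧ 1 * (3 / 4 : ℝ) / p.2 < 1}).toReal
  let Wsh : ℕ → ℝ := fun K =>
    (2 * ((((0 : ℕ) : ℝ) + 1) * (1 : ℝ) * (2 * (1 / 2 : ℝ)⁻¹) * (1 / 8 : ℝ) * (1 / 2 : ℝ)⁻¹ ^ (0 : ℕ))) * (1 / 2 : ℝ) ^ K
  have hρ0 : ∀ j, 0 < ρ j := fun j => by positivity
  have hρ1 : ∀ j, ρ j < 1 := fun j => by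
    have : (1 / 2 : ℝ) ^ j ≤ 1 := pow_le_one₀ (by norm_num) (by norm_num)
    show (1 / 2 : ℝ) ^ j / 8 < 1
    linarith
  have htot : (μ₀ univ).toReal = 1 / 2 := by
    show (((Measure.dirac ()).prod (volume.restrict (Icc ((1 - (1 / 2 : ℝ)) * 1) 1))) univ).toReal = 1 / 2
    rw [toyMix_total, ENNReal.toReal_ofReal (by norm_num)]
  have hshell_pos : ∀ K, 0 < shell K := fun K => toyMix_shell_pos (hρ0 K) (hρ1 K)
  have hshell_le : ∀ K, shell K ≤ 1 / 2 := fun K => by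
    rw [← htot]
    exact ENNReal.toReal_mono (measure_ne_top _ _) (measure_mono (subset_univ _))
  have hWpos : ∀ K, 0 < Wsh K := fun K => by positivity
  have hWsum : Summable Wsh := (summable_geometric_of_lt_one (by norm_num) (by norm_num : (1 / 2 : ℝ) < 1)).mul_left _
  -- the bundle: one term per step, weights = total mass, shell parts = shell mass, in both runs
  let Sb : SpineCarriers :=
    { ι := Unit, l₀ := 1, vol := 1, K₀ := 0, T := T, A := fun _ _ _ => 1 / 2, B := fun _ _ _ => 1 / 2,
      shA := fun K _ _ => shell K, shB := fun K _ _ => shell K, Bad := fun _ _ => ∅, W := fun _ => 0, Wsh := Wsh, δ := fun _ => 0 }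
  -- the reading package at the toy data (both runs identical)
  have hpkg : ∀ S : SpineCarriers, S = Sb →
      ∃ (σA σB : Type) (XA : ℕ → σA → Type) (XB : ℕ → σB → Type)
        (_mA : ∀ K s, MeasurableSpace (XA K s)) (_mB : ∀ K s, MeasurableSpace (XB K s))
        (νA : ∀ K : ℕ, ℝ → ∀ s : σA, Measure (XA K s)) (νB : ∀ K : ℕ, ℝ → ∀ s : σB, Measure (XB K s))
        (_fA : ∀ K t s, IsFiniteMeasure (νA K t s)) (_fB : ∀ K t s, IsFiniteMeasure (νB K t s))
        (wA : ∀ K : ℕ, ℝ → ∀ s : σA, XA K s → ℝ) (wB : ∀ K : ℕ, ℝ → ∀ s : σB, XB K s → ℝ)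
        (SA : ℕ → Finset σA) (SB : ℕ → Finset σB)
        (pieceA : ℕ → ℝ → σA → S.ι → ℝ) (pieceB : ℕ → ℝ → σB → S.ι → ℝ)
        (lvlA : ℕ → σA → ℕ) (lvlB : ℕ → σB → ℕ) (θA κA ρA θB κB ρB : ℕ → ℝ)
        (MA : ℕ → ℝ → σA → ℝ) (MB : ℕ → ℝ → σB → ℝ) (N₁ : ℕ) (νbar κmin c₁ ϑ : ℝ),
        (∀ K t, |t| ≤ S.l₀ → ∀ τ ∈ S.T K, 0 ≤ S.shA K t τ) ∧
        (∀ K t, |t| ≤ S.l₀ → ∀ τ ∈ S.T K, S.shA K t τ ≤ S.A K t τ) ∧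
        (∀ K t, |t| ≤ S.l₀ → ∀ τ ∈ S.T K, S.shA K t τ ≤ ∑ s ∈ SA K, pieceA K t s τ) ∧
        (∀ K t s, Measurable (wA K t s)) ∧ (∀ j, 0 < θA j) ∧ (∀ j, 0 < κA j ∧ κA j < 1) ∧ (∀ j, 0 ≤ ρA j) ∧
        (∀ K t, |t| ≤ S.l₀ → ∀ s ∈ SA K, 0 ≤ MA K t s) ∧
        (∀ K t, |t| ≤ S.l₀ → ∀ s ∈ SA K, ∑ τ ∈ S.T K, pieceA K t s τ ≤ MA K t s *
          (((νA K t s).prod (volume.restrict (Icc ((1 - κA (lvlA K s)) * θA (lvlA K s)) (θA (lvlA K s)))))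
            {p | θA (lvlA K s) * (1 - ρA (lvlA K s)) ≤ θA (lvlA K s) * wA K t s p.1 / p.2 ∧
              θA (lvlA K s) * wA K t s p.1 / p.2 < θA (lvlA K s)}).toReal) ∧
        (∀ K t, |t| ≤ S.l₀ → ∀ s ∈ SA K, MA K t s *
          (((νA K t s).prod (volume.restrict (Icc ((1 - κA (lvlA K s)) * θA (lvlA K s)) (θA (lvlA K s))))) univ).toReal ≤
            ∑ τ ∈ S.T K, S.A K t τ) ∧
        (∀ K t, |t| ≤ S.l₀ → ∀ τ ∈ S.T K, 0 ≤ S.shB K t τ) ∧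
        (∀ K t, |t| ≤ S.l₀ → ∀ τ ∈ S.T K, S.shB K t τ ≤ S.B K t τ) ∧
        (∀ K t, |t| ≤ S.l₀ → ∀ τ ∈ S.T K, S.shB K t τ ≤ ∑ s ∈ SB K, pieceB K t s τ) ∧
        (∀ K t s, Measurable (wB K t s)) ∧ (∀ j, 0 < θB j) ∧ (∀ j, 0 < κB j ∧ κB j < 1) ∧ (∀ j, 0 ≤ ρB j) ∧
        (∀ K t, |t| ≤ S.l₀ → ∀ s ∈ SB K, 0 ≤ MB K t s) ∧
        (∀ K t, |t| ≤ S.l₀ → ∀ s ∈ SB K, ∑ τ ∈ S.T K, pieceB K t s τ ≤ MB K t s *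
          (((νB K t s).prod (volume.restrict (Icc ((1 - κB (lvlB K s)) * θB (lvlB K s)) (θB (lvlB K s)))))
            {p | θB (lvlB K s) * (1 - ρB (lvlB K s)) ≤ θB (lvlB K s) * wB K t s p.1 / p.2 ∧
              θB (lvlB K s) * wB K t s p.1 / p.2 < θB (lvlB K s)}).toReal) ∧
        (∀ K t, |t| ≤ S.l₀ → ∀ s ∈ SB K, MB K t s *
          (((νB K t s).prod (volume.restrict (Icc ((1 - κB (lvlB K s)) * θB (lvlB K s)) (θB (lvlB K s))))) univ).toReal ≤
            ∑ τ ∈ S.T K, S.B K t τ) ∧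
        LiveWindow SA lvlA N₁ νbar ∧ LiveWindow SB lvlB N₁ νbar ∧ 0 < κmin ∧ (∀ j, κmin ≤ κA j) ∧ (∀ j, κmin ≤ κB j) ∧
        0 < ϑ ∧ ϑ < 1 ∧ (∀ j, ρA j ≤ c₁ * ϑ ^ j) ∧ (∀ j, ρB j ≤ c₁ * ϑ ^ j) ∧
        (∀ K, (2 * ((N₁ + 1) * νbar * (2 * κmin⁻¹) * c₁ * ϑ⁻¹ ^ N₁)) * ϑ ^ K ≤ S.Wsh K) ∧ Summable S.Wsh := by
    rintro S rfl
    -- the one-run package (used twice)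
    have hsh0 : ∀ (K : ℕ) (t : ℝ), |t| ≤ (1 : ℝ) → ∀ τ ∈ T K, 0 ≤ shell K := fun K _ _ _ _ => (hshell_pos K).le
    have hshle : ∀ (K : ℕ) (t : ℝ), |t| ≤ (1 : ℝ) → ∀ τ ∈ T K, shell K ≤ 1 / 2 := fun K _ _ _ _ => hshell_le K
    have hcov : ∀ (K : ℕ) (t : ℝ), |t| ≤ (1 : ℝ) → ∀ τ ∈ T K, shell K ≤ ∑ _s ∈ S K, 1 * shell K := fun K _ _ _ _ => by
      simp [S]
    have hpush : ∀ (K : ℕ) (t : ℝ), |t| ≤ (1 : ℝ) → ∀ s ∈ S K, ∑ _τ ∈ T K, 1 * shell K ≤ 1 *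
        (((Measure.dirac ()).prod (volume.restrict (Icc ((1 - (1 / 2 : ℝ)) * 1) 1)))
          {p : Unit × ℝ | 1 * (1 - ρ (lvl K s)) ≤ 1 * (3 / 4 : ℝ) / p.2 ∧ 1 * (3 / 4 : ℝ) / p.2 < 1}).toReal := fun K _ _ s _ => by
      rw [show T K = {()} from rfl, Finset.sum_singleton]
      exact le_of_eq (by rw [one_mul, one_mul]; rfl)
    have htotal : ∀ (K : ℕ) (t : ℝ), |t| ≤ (1 : ℝ) → ∀ s ∈ S K, 1 *
        (((Measure.dirac ()).prod (volume.restrict (Icc ((1 - (1 / 2 : ℝ)) * 1) 1))) univ).toReal ≤ ∑ _τ ∈ T K, (1 / 2 : ℝ) :=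
      fun K _ _ _ _ => by rw [show T K = {()} from rfl, Finset.sum_singleton, one_mul]; exact htot.le
    have hrate : ∀ j, ρ j ≤ 1 / 8 * (1 / 2 : ℝ) ^ j := fun j => by show (1 / 2 : ℝ) ^ j / 8 ≤ _; linarith
    exact ⟨Unit, Unit, fun _ _ => Unit, fun _ _ => Unit, inferInstance, inferInstance,
      fun _ _ _ => Measure.dirac (), fun _ _ _ => Measure.dirac (), fun _ _ _ => inferInstance, fun _ _ _ => inferInstance,
      fun _ _ _ _ => (3 / 4 : ℝ), fun _ _ _ _ => (3 / 4 : ℝ), S, S, fun K _ _ _ => 1 * shell K, fun K _ _ _ => 1 * shell K, lvl, lvl,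
      fun _ => (1 : ℝ), fun _ => (1 / 2 : ℝ), ρ, fun _ => (1 : ℝ), fun _ => (1 / 2 : ℝ), ρ, fun _ _ _ => (1 : ℝ), fun _ _ _ => (1 : ℝ),
      0, (1 : ℝ), (1 / 2 : ℝ), (1 / 8 : ℝ), (1 / 2 : ℝ),
      hsh0, hshle, hcov, fun _ _ _ => measurable_const, fun _ => one_pos, fun _ => by norm_num, fun j => (hρ0 j).le,
      fun _ _ _ _ _ => zero_le_one, hpush, htotal,
      hsh0, hshle, hcov, fun _ _ _ => measurable_const, fun _ => one_pos, fun _ => by norm_num, fun j => (hρ0 j).le,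
      fun _ _ _ _ _ => zero_le_one, hpush, htotal,
      liveWindow, liveWindow, by norm_num, fun _ => le_refl (1 / 2 : ℝ), fun _ => le_refl (1 / 2 : ℝ), by norm_num, by norm_num,
      hrate, hrate, fun K => le_rfl, hWsum⟩
  refine ⟨fun _ _ _ _ S => S = Sb, ⟨F, Dat, fun _ => 0, [], Sb, rfl, fun K => ⟨(), by simp [Sb, T]⟩, fun K t τ => ?_, hWpos⟩,
    s_N21_of_mixtureSlotReading _ fun _ _ _ _ S hS => hpkg S hS⟩
  exact ⟨by norm_num [Sb], by norm_num [Sb], hshell_pos K, hshell_pos K⟩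

end NonVacuity

end Summit.QuantumFields.YangMills.Theorems.N21MixtureSlotMeasure

end
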